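import Summits.HodgeConjecture.HodgeConjecture.Theses.PeriodDeficiency
import HarnessLib

/-!
# Route PeriodDeficiency — `QbarGenericIsHodgeGeneric` (stmt-HodgeConjecture-11595), line `registered`: stub `stub_irredClosed_hasMaximal`

The registered stub `stub_irredClosed_hasMaximal` (stub 1b, "maximal members of families of
irreducible closed algebraic subvarieties") of the line skeleton
`Cruxes/QbarGenericIsHodgeGeneric/Lines/birth.lean`, proved UNCONDITIONALLY.

**Statement.** For `σ : ℚ̄ →+* ℂ` and a smooth `ℚ̄`-scheme `S₀`, put `S = S₀ ⊗_σ ℂ`. Every non-empty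
family `F` of subsets `A ⊆ S(ℂ)` which are irreducible and closed for the Zariski topology on
`S(ℂ)` (`IsIrreducibleZariskiClosedOnPoints`, the topology on `ZariskiPoints S ℂ` induced from the
scheme `S` along `P ↦ P.pt`) has a maximal member. (Baldi–Klingler–Ullmo, §3.1: "by a subvariety
we always mean a closed algebraic subvariety"; this is the ascending chain condition on irreducible
closed subvarieties, used to form "special closures".)

**Proof.** `S` is locally of finite type over `ℂ`, hence a locally Noetherian scheme
(Mathlib `LocallyOfFiniteType.isLocallyNoetherian`). If `F` had no maximal member, dependent choice
would give a strictly increasing sequence `Y₀ ⊊ Y₁ ⊊ ⋯` in `F`. The closures `Zₖ` in `S` of the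
underlying points of `Yₖ` are irreducible closed subsets of `S` with `Yₖ = pt⁻¹(Zₖ)` (a Zariski-closed
set of points is `pt⁻¹` of a closed set), so `Z₀ ⊊ Z₁ ⊊ ⋯`. Schemes are sober: let `ηₖ` be the
generic point of `Zₖ`; then `ηₖ₊₁ ⤳ ηₖ`, all `ηₖ` are distinct, and all lie in one affine open
`U = Spec R ∋ η₀` (open sets are stable under generization), `R = Γ(S, U)` Noetherian. In `Spec R`
specialization is the order on primes, so the `ηₖ` give a strictly decreasing sequence of primes
`𝔭₀ ⊋ 𝔭₁ ⊋ ⋯`, all below `𝔭₀` — impossible, since by Krull's height theorem every prime of a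
Noetherian ring has finite height (Mathlib `Ideal.finiteHeight_of_isNoetherianRing`), whereas the
chain forces `height 𝔭₀ = ⊤` (`Order.height_le_height_apply_of_strictMono` along `ℕᵒᵈ`).
(Note: a Noetherian topological space has the DESCENDING chain condition on closed sets; the
ascending chain condition on IRREDUCIBLE closed sets is the finiteness of heights of primes.) The
hypothesis `IrreducibleSpace S₀.left` of the registered signature is not used.

Everything used is proved in Mathlib or is definitional in the tree; no named fact is assumed.

## References

* G. Baldi, B. Klingler, E. Ullmo, On the distribution of the Hodge locus, Invent. Math. 235
  (2024), §3.1. [BaldiKlinglerUllmo2024]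
* A. Grothendieck, J. Dieudonné, EGA I, 2.1 (schemes are sober) and EGA IV₁, 0.14 (dimension
  theory); Stacks Project, Tags 00KG and 0BCN (primes of a Noetherian ring have finite height).
-/

noncomputable section

-- every declaration of this problem lives in `Summit.HodgeConjecture.HodgeConjecture.…` (summit = sub-problem)
set_option linter.dupNamespace false

open CategoryTheory AlgebraicGeometry Literature.AlgebraicGeometry.Motives
  Literature.AlgebraicGeometry.HodgeTheory
open Topology

namespace Summit.HodgeConjecture.HodgeConjecture.Theorems

universe u

/-- **No strictly decreasing sequence of primes in a Noetherian ring.** For `R` Noetherian there is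
no strictly decreasing sequence `𝔭₀ ⊋ 𝔭₁ ⊋ ⋯` of prime ideals: all `𝔭ₖ` lie below `𝔭₀`, so the
chain forces `height 𝔭₀ = ⊤`, contradicting Krull's height theorem (every prime of a Noetherian
ring has finite height, Mathlib `Ideal.finiteHeight_of_isNoetherianRing`; Stacks Tags 00KG, 0BCN). [folklore] -/
theorem not_strictAnti_primeSpectrum_of_isNoetherianRing {R : Type u} [CommRing R]
    [IsNoetherianRing R] (q : ℕ → PrimeSpectrum R) : ¬ StrictAnti q := by
  intro hq
  have h₁ : Order.height (OrderDual.toDual (0 : ℕ)) ≤ Order.height (q 0) :=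
    Order.height_le_height_apply_of_strictMono (q ∘ OrderDual.ofDual) hq.dual_left
      (OrderDual.toDual 0)
  rw [Order.height_toDual, Order.coheight_nat, top_le_iff] at h₁
  have h₂ : (q 0).asIdeal.height < ⊤ := Ideal.height_lt_top (q 0).isPrime.ne_top
  rw [PrimeSpectrum.height_eq_orderHeight, h₁] at h₂
  exact lt_irrefl _ h₂

/-- **Generization chains in a locally Noetherian scheme stabilise.** If `X` is a locally Noetherian
scheme and `x : ℕ → X` is a sequence of points each generizing the previous one
(`x (k+1) ⤳ x k`), then two consecutive terms coincide. Indeed all `x k` lie in an affine open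
`Spec R ∋ x 0` (`R` Noetherian; open sets are stable under generization), where specialization is
the order on prime ideals (`PrimeSpectrum.le_iff_specializes`), and a Noetherian ring has no
strictly decreasing sequence of primes (`not_strictAnti_primeSpectrum_of_isNoetherianRing`). [folklore] -/
theorem exists_succ_eq_of_specializes {X : Scheme.{u}} [IsLocallyNoetherian X] (x : ℕ → X)
    (hx : ∀ k, x (k + 1) ⤳ x k) : ∃ k, x (k + 1) = x k := by
  by_contra hne
  push Not at hne
  obtain ⟨U, hU, hx₀, -⟩ := exists_isAffineOpen_mem_and_subset (X := X) (x := x 0)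
    (U := ⊤) (TopologicalSpace.Opens.mem_top _)
  have hmem : ∀ k, x k ∈ (U : Set X) := by
    intro k
    induction k with
    | zero => exact hx₀
    | succ k ih => exact (hx k).mem_open U.isOpen ih
  haveI : IsNoetherianRing Γ(X, U) := IsLocallyNoetherian.component_noetherian ⟨U, hU⟩
  have hrange : ∀ k, x k ∈ Set.range hU.fromSpec := fun k => by
    rw [IsAffineOpen.range_fromSpec]; exact hmem k
  choose q hq using hrange
  have hemb : IsOpenEmbedding hU.fromSpec := hU.fromSpec.isOpenEmbedding
  refine not_strictAnti_primeSpectrum_of_isNoetherianRing (R := Γ(X, U)) q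
    (strictAnti_nat_of_succ_lt fun k => lt_of_le_of_ne ?_ ?_)
  · rw [PrimeSpectrum.le_iff_specializes]
    have h := hx k
    rw [← hq (k + 1), ← hq k] at h
    exact hemb.isInducing.specializes_iff.mp h
  · intro h
    apply hne k
    rw [← hq (k + 1), ← hq k]
    exact congrArg _ h

/-- **Ascending chains of irreducible closed subsets of a locally Noetherian scheme stabilise.**
If `Z : ℕ → Set X` is an increasing sequence of irreducible closed subsets of a locally Noetherian
scheme `X`, then `Z (k+1) ⊆ Z k` for some `k`: apply `exists_succ_eq_of_specializes` to the generic
points (schemes are sober; `Z k ⊆ Z (k+1)` says the generic point of `Z (k+1)` generizes that of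
`Z k`). [folklore] -/
theorem exists_succ_subset_of_isIrreducible_isClosed {X : Scheme.{u}} [IsLocallyNoetherian X]
    (Z : ℕ → Set X) (hc : ∀ k, IsClosed (Z k)) (hi : ∀ k, IsIrreducible (Z k))
    (hmono : ∀ k, Z k ⊆ Z (k + 1)) : ∃ k, Z (k + 1) ⊆ Z k := by
  have hg : ∀ k, IsGenericPoint (hi k).genericPoint (Z k) := fun k =>
    (hi k).isGenericPoint_genericPoint (hc k)
  obtain ⟨k, hk⟩ := exists_succ_eq_of_specializes (fun k => (hi k).genericPoint)
    (fun k => (hg (k + 1)).specializes (hmono k (hg k).mem))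
  refine ⟨k, ?_⟩
  rw [← (hg (k + 1)).def, ← (hg k).def]
  exact (congrArg (fun y : X => closure ({y} : Set X)) hk).le

/-- **STUB 1b of the line `registered` of the crux `QbarGenericIsHodgeGeneric` — maximal members of
families of irreducible closed algebraic subvarieties.** For `σ : ℚ̄ →+* ℂ`, a smooth `ℚ̄`-scheme
`S₀` and `S = S₀ ⊗_σ ℂ`, every non-empty family of subsets of `S(ℂ)` which are irreducible and
Zariski closed (`IsIrreducibleZariskiClosedOnPoints`) has a maximal member: the ascending chain
condition on irreducible closed subvarieties (BKU §3.1, "closed algebraic subvariety"). Proof: a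
strictly increasing sequence in the family would give a strictly increasing sequence of irreducible
closed subsets of the locally Noetherian scheme `S` (closures of the underlying points; a
Zariski-closed set of points is `pt⁻¹` of a closed set), contradicting
`exists_succ_subset_of_isIrreducible_isClosed`. The hypothesis `IrreducibleSpace S₀.left` is not
used. [cite: BaldiKlinglerUllmo2024, §3.1] -/
theorem stub_irredClosed_hasMaximal :
    ∀ (σ : AlgebraicClosure ℚ →+* ℂ) ⦃S₀ : SchemeOver (AlgebraicClosure ℚ)⦄,
      IrreducibleSpace S₀.left → AlgebraicGeometry.Smooth S₀.hom →
      ∀ F : Set (Set (ComplexPoints ((baseChangeHom σ).obj S₀))), F.Nonempty →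
        (∀ A ∈ F, IsIrreducibleZariskiClosedOnPoints ((baseChangeHom σ).obj S₀) A) →
        ∃ M ∈ F, ∀ A ∈ F, M ⊆ A → A = M := by
  intro σ S₀ _ hsm F hF hirr
  -- `S = S₀ ⊗_σ ℂ` is locally of finite type over `ℂ`, hence locally Noetherian
  haveI := hsm
  haveI : AlgebraicGeometry.Smooth ((baseChangeHom σ).obj S₀).hom :=
    inferInstanceAs (AlgebraicGeometry.Smooth
      (Limits.pullback.snd S₀.hom (Spec.map (CommRingCat.ofHom σ))))
  haveI : IsLocallyNoetherian ((baseChangeHom σ).obj S₀).left :=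
    LocallyOfFiniteType.isLocallyNoetherian ((baseChangeHom σ).obj S₀).hom
  by_contra h
  push Not at h
  -- a strictly increasing sequence `Y` in `F`
  choose! next hnext hsub hne using h
  obtain ⟨A₀, hA₀⟩ := hF
  obtain ⟨Y, hY₀, hYsucc⟩ : ∃ Y : ℕ → Set (ComplexPoints ((baseChangeHom σ).obj S₀)),
      Y 0 = A₀ ∧ ∀ k, Y (k + 1) = next (Y k) :=
    ⟨fun k => next^[k] A₀, rfl, fun k => Function.iterate_succ_apply' next k A₀⟩
  have hY : ∀ k, Y k ∈ F := by
    intro k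
    induction k with
    | zero => exact hY₀ ▸ hA₀
    | succ k ih => exact hYsucc k ▸ hnext _ ih
  have hYmono : ∀ k, Y k ⊆ Y (k + 1) := fun k => by
    rw [hYsucc]
    exact hsub _ (hY k)
  -- the closures of the underlying points: an increasing chain of irreducible closed subsets of `S`
  have hf : Continuous (fun P : ZariskiPoints ((baseChangeHom σ).obj S₀) ℂ => P.val.pt) :=
    continuous_induced_dom
  obtain ⟨k, hk⟩ := exists_succ_subset_of_isIrreducible_isClosed
    (fun k => closure ((fun P : ZariskiPoints ((baseChangeHom σ).obj S₀) ℂ => P.val.pt) ''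
      zariskiSet ((baseChangeHom σ).obj S₀) (Y k)))
    (fun _ => isClosed_closure)
    (fun k => ((hirr _ (hY k)).2.image _ hf.continuousOn).closure)
    (fun k => closure_mono (Set.image_mono (Set.preimage_mono (hYmono k))))
  -- hence `Y (k+1) ⊆ Y k`, contradicting strictness
  apply hne _ (hY k)
  rw [← hYsucc k]
  refine le_antisymm (fun P hP => ?_) (hYmono k)
  obtain ⟨C, hC, hCY⟩ := isClosed_induced_iff.mp (hirr _ (hY k)).1
  have hZC : closure ((fun P : ZariskiPoints ((baseChangeHom σ).obj S₀) ℂ => P.val.pt) ''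
      zariskiSet ((baseChangeHom σ).obj S₀) (Y k)) ⊆ C := by
    refine closure_minimal ?_ hC
    rintro _ ⟨Q, hQ, rfl⟩
    rw [← hCY] at hQ
    exact hQ
  have hP' : (show ZariskiPoints ((baseChangeHom σ).obj S₀) ℂ from P) ∈
      (fun P : ZariskiPoints ((baseChangeHom σ).obj S₀) ℂ => P.val.pt) ⁻¹' C :=
    hZC (hk (subset_closure ⟨_, hP, rfl⟩))
  rw [hCY] at hP'
  exact hP'

end Summit.HodgeConjecture.HodgeConjecture.Theorems
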